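import Mathlib

/-!
# LO(4,5): Laplace optimality of the `4 × 5` injective pattern — definition
# (crux `RankRigidMinimalRepr`, stmt-ValiantsHypothesis-18034; frontier rung `LaplaceOptimalFive`, stmt-24813)

The programme on `LaplaceOptimal 5` (`…LaplaceDefs.lean`; closed classes `a = 4`, `a = 3`, open `a ≤ 2`) has a natural
intermediate rung one letter up from `laplaceOptimal_four`: the RECTANGULAR pattern `P₄,₅(v) = [v : Fin 4 → Fin 5 injective]`.
Its flattening ranks are `5` (one slot against three) and `C(5,2) = 10` (two against two: the disjointness matrix of the
`2`-subsets of `[5]`), so Laplace expansion along one slot (`5` slices) or along two slots (`10` pairs) is tight for the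
weighted count below, exactly as for the square patterns.

* `LaplaceOptimalFourFive` — «every split-rank-one decomposition `Σ_t u_t(v|_{S_t}) w_t(v|_{S_tᶜ}) = P₄,₅` has
  `Σ_t wt |S_t| ≥ 10`», `wt 2 = 1` (pairs), `wt 1 = wt 3 = 2` (slices), `wt 0 = wt 4 = 10` (trivial splits); i.e.
  `Σ_t 1 / rank_{S_t}(P₄,₅) ≥ 1`.  Written in the data format of `LaplaceOptimal` (terms indexed by a `Finset`, dependence
  sets `S_t ⊆ Fin 4`, letters `Fin 5`) and with the integer weights used VERBATIM as the hypothesis `hR` of the transfer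
  theorems `LaplaceContractRect.no_idle_slot_of_rect` / `contract_five_rect` (`…LaplaceContractRect{,Five}.lean`), so that
  `h45 : LaplaceOptimalFourFive` feeds them by `exact`.

WHY IT MATTERS (memo NOTE-w1g1-24813-LO45-rung on stmt-24813): contracting one slot of a cheap decomposition of `P₅` against a
covector with all coordinates non-zero lands in `P₄,₅`; given `LaplaceOptimalFourFive`, 342/350 (`a = 2`), 375/606 (`a = 1`)
and the 111 idle-slot (`a = 0`) maximal cheap profiles of `P₅` are impossible (up to letter-indicator slices), and together
with the landed certificate engines the class `a = 2` shrinks to 5 profile types.  STATUS: OPEN — a conjecture of exactly the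
shape of `laplaceOptimal_four` (19 maximal cheap profiles there, 57 here; the two-slot contraction is the `5 × 5` pencil
`[x ≠ y](T - t_x - t_y)`); nothing is asserted.  HONEST FRAMING: a definition only; `LaplaceOptimalFive` (stmt-24813), the crux
and `VP ≠ VNP` are untouched.
-/

set_option autoImplicit false

-- the mandated summit-side namespace repeats a component by design (single-problem summit)
set_option linter.dupNamespace false

namespace Summit.ValiantsHypothesis.ValiantsHypothesis.Theorems.RigidityForcesSymmetryRankRigidMinimalRepr

/-- **LO(4,5) — Laplace optimality of the `4`-slot, `5`-letter injective pattern** (a weighted partition-rank bound; OPEN,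
conjectured): for every finite family of split-rank-one terms `u_t(v) · w_t(v)` — `u_t` a function of `v|_{S_t}`, `w_t` of
`v|_{(S_t)ᶜ}`, `S_t ⊆ Fin 4` — summing to `[v injective]` on `Fin 4 → Fin 5`, the weights `wt |S_t|` (`1` for `|S_t| = 2`,
`2` for `|S_t| ∈ {1,3}`, `10` for `|S_t| ∈ {0,4}`; `= 10 / rank` of the corresponding flattening) sum to at least `10`.
Tight for Laplace expansion along one slot or along two slots. -/
def LaplaceOptimalFourFive : Prop :=
  ∀ (N : ℕ) (T : Finset (Fin N)) (S : Fin N → Finset (Fin 4)) (u w : Fin N → (Fin 4 → Fin 5) → ℂ),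
    (∀ t, ∀ v v' : Fin 4 → Fin 5, (∀ k ∈ S t, v k = v' k) → u t v = u t v') →
    (∀ t, ∀ v v' : Fin 4 → Fin 5, (∀ k, k ∉ S t → v k = v' k) → w t v = w t v') →
    (∀ v : Fin 4 → Fin 5, (∑ t ∈ T, u t v * w t v) = if Function.Injective v then 1 else 0) →
    10 ≤ ∑ t ∈ T, (if (S t).card = 2 then 1 else if (S t).card = 1 ∨ (S t).card = 3 then 2 else 10)

end Summit.ValiantsHypothesis.ValiantsHypothesis.Theorems.RigidityForcesSymmetryRankRigidMinimalRepr
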